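import Summits.AtomisticToContinuum.HydrodynamicLimit.Theses.JParityClosure
import Summits.AtomisticToContinuum.HydrodynamicLimit.Theorems.SuperextensiveClosureCostTransferInequality
import Summits.AtomisticToContinuum.HydrodynamicLimit.Theorems.JParityClosureOddContactSymmetryKineticSlabWindowRate
import HarnessLib

/-!
# `OddContactSymmetry` reduced to the kinetic-slab pressure bet and the two-scale transfer (line `KineticSlabSketch`)

Crux `JParityClosure.OddContactSymmetry` (stmt-AtomisticToContinuum-17722, rev 5), line `KineticSlabSketch` (card
`kinetic-slab-entropy-spending`), lead `prover-line-stmt-AtomisticToContinuum-17722-0`.  CONDITIONAL form of the registered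
skeleton `Cruxes/OddContactSymmetry/Lines/KineticSlabSketch.lean`:

* `oddContactSymmetry_iff_metroOddStat` — the crux is the statement about `metroOddStat` (`Iff.rfl`).
* `oddContactSymmetry_of_slabPressure_of_scaleTransfer (hS1 : S1) (hS6 : S6) : OddContactSymmetry` — from
  `windowRate_of_slabPressure` (companion file `…KineticSlabWindowRate`), the PROVED `TransferInequality`
  (`transferInequality_proof`: `LG(S)² ≤ e^{C(N+1)} G(S)` for every set `S`, `G = localGibbsLaw σ 1 0 θe`, `θ₀ < 2θe`) and S6,
  by the union bound `LG{η < |D_r|} ≤ LG{η/2 < |D_{r_K}|} + LG{η/2 < |D_r − D_{r_K}|} ≤ e^{(C−M)(N+1)/2} + δ/2`.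

S1 (`stub_slabPressure`, the card's bet in pressure form: equilibrium, one kinetic slab, rate divergence in `K`) and S6
(`stub_scaleTransfer`, the pre-shock two-scale consistency (2B) that every fixed-`r` line owes, K1-strength) are the line's two
registered OPEN stubs, taken here verbatim as hypotheses; nothing else is assumed.
-/

noncomputable section

open scoped BigOperators Classical InnerProductSpace ENNReal Topology
open Set MeasureTheory Filter
open Literature.Analysis.FluidPDE Literature.MathematicalPhysics.KineticTheory
open Summit.AtomisticToContinuum.HydrodynamicLimit.Theses.JParityClosure

namespace Summit.AtomisticToContinuum.HydrodynamicLimit.Theorems.OddContactSymmetryKineticSlab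

/-! ## The crux, named -/

/-- The crux is the statement about `metroOddStat` (definitional unfolding of the route's `let`-chain). [folklore] -/
theorem oddContactSymmetry_iff_metroOddStat :
    OddContactSymmetry ↔
    ∃ η₀ : ℝ, 0 < η₀ ∧ ∀ (a₀ θ₀ : T3 → ℝ) (u₀ : T3 → V3), Continuous a₀ → Continuous θ₀ → Continuous u₀ →
      (∀ x, 0 < a₀ x) → (∀ x, 0 < θ₀ x) → ∃ σ₀ : ℝ, 0 < σ₀ ∧ ∀ σ : ℝ, 0 < σ → σ < σ₀ →
      ∀ (T : ℝ) (ρ θ : ℝ → T3 → ℝ) (u : ℝ → T3 → V3), IsHardSphereEulerSolution σ T ρ u θ →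
      ∀ Φ : (N : ℕ) → HardSphereFlow (Torus.geometry (Fin 3)) (hsDiameter σ N) (N + 1),
      TendstoHydroFieldsAt (fun N => localGibbsLaw σ a₀ u₀ θ₀ N (Φ N)) Φ ρ u θ 0 →
      ∀ τ : ℝ, 0 < τ → τ < T → ∀ χ : ℝ × UnitAddTorus (Fin 3) → ℝ, Continuous χ → ∀ g : ℝ → ℝ, Continuous g →
      (∀ a, η₀ ≤ a → g a = 0) →
      ∀ Ψ : EuclideanSpace ℝ (Fin 3) × EuclideanSpace ℝ (Fin 3) × EuclideanSpace ℝ (Fin 3) → ℝ, Continuous Ψ →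
      (∃ C : ℝ, ∀ q, |Ψ q| ≤ C) →
      (∀ (n v w : EuclideanSpace ℝ (Fin 3)), ‖n‖ = 1 →
        Ψ (-n, (reflectVel n (v, w)).1, (reflectVel n (v, w)).2) = -Ψ (n, v, w)) →
      ∀ η δ : ℝ, 0 < η → 0 < δ → ∃ r₀ : ℝ, 0 < r₀ ∧ ∀ r ϑ : ℝ, 0 < r → r < r₀ → 0 < ϑ → ϑ < r₀ →
      ∃ N₀ : ℕ, ∀ N : ℕ, N₀ ≤ N →
        localGibbsLaw σ a₀ u₀ θ₀ N (Φ N) {z | η < |metroOddStat σ N (Φ N) τ χ g Ψ r ϑ z|} ≤ ENNReal.ofReal δ :=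
  Iff.rfl

/-! ## Composition, step 2: the crux -/

/-- **The crux `OddContactSymmetry` from the line's two open stubs taken as hypotheses** (`windowRate_of_slabPressure`, the
PROVED `TransferInequality`, and S6): with `η₀ = min η₀^{S1} η₀^{S6}`, `θe = 1 + sup θ₀`, `σ₀` the minimum of the three
thresholds, and for given `η, δ`: `r₀` from S6 at `(η/2, δ/2)`; `K` large for S6 and for `windowRate` at
`x = η/2`, `M = |C| + 1` (`C` the transfer constant); then
`LG{η < |D_r|} ≤ LG{η/2 < |D_{r_K}|} + LG{η/2 < |D_r − D_{r_K}|} ≤ e^{(C − M)(N+1)/2} + δ/2 ≤ δ`. [folklore] -/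
theorem oddContactSymmetry_of_slabPressure_of_scaleTransfer : (∃ η₀ : ℝ, 0 < η₀ ∧ ∀ θe : ℝ, 0 < θe → ∃ σ₀ : ℝ, 0 < σ₀ ∧ ∀ σ : ℝ, 0 < σ → σ < σ₀ → ∀ Φ : (N : ℕ) → HardSphereFlow (Torus.geometry (Fin 3)) (hsDiameter σ N) (N + 1), ∀ τ : ℝ, 0 < τ → ∀ χ : ℝ × UnitAddTorus (Fin 3) → ℝ, Continuous χ → ∀ g : ℝ → ℝ, Continuous g → (∀ a, η₀ ≤ a → g a = 0) → ∀ Ψ : V3 × V3 × V3 → ℝ, Continuous Ψ → (∃ C : ℝ, ∀ q, |Ψ q| ≤ C) → (∀ (n v w : V3), ‖n‖ = 1 → Ψ (-n, (reflectVel n (v, w)).1, (reflectVel n (v, w)).2) = -Ψ (n, v, w)) → ∀ ϑ : ℝ, 0 < ϑ → ∀ b y : ℝ, 0 < b → 0 < y → ∃ K₀ : ℕ, ∀ K : ℕ, K₀ ≤ K → ∃ N₀ : ℕ, ∀ N : ℕ, N₀ ≤ N → ∀ s ∈ Set.Icc (0 : ℝ) τ, ∀ ℓ : ℝ, (K : ℝ)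 * ((N + 1 : ℕ) : ℝ) ^ (-(1 / 3 : ℝ)) / 2 ≤ ℓ → ℓ ≤ (K : ℝ) * ((N + 1 : ℕ) : ℝ) ^ (-(1 / 3 : ℝ)) → ∀ b' : ℝ, b / 2 ≤ b' → b' ≤ b → ∫⁻ z, ENNReal.ofReal (Real.exp (b' / K * |metroOddSum σ N (Φ N) (Set.Ioc 0 ℓ) (fun p => χ (p.1 + s, p.2)) g Ψ ((K : ℝ) ^ (1 / 4 : ℝ) * ((N + 1 : ℕ) : ℝ) ^ (-(1 / 3 : ℝ))) ϑ z|)) ∂(localGibbsLaw σ (fun _ => 1) (fun _ => 0) (fun _ => θe) N (Φ N)) ≤ ENNReal.ofReal (Real.exp (b' * y * ((N : ℝ) + 1)))) → (∃ η₀ : ℝ, 0 < η₀ ∧ ∀ (a₀ θ₀ : T3 → ℝ) (u₀ : T3 → V3), Continuous a₀ → Continuous θ₀ → Continuous u₀ → (∀ x, 0 < a₀ x) → (∀ x, 0 < θ₀ x) → ∃ σ₀ : ℝ, 0 < σ₀ ∧ ∀ σ : ℝ, 0 < σ → σ < σ₀ → ∀ (T : ℝ) (ρ θ : ℝ → T3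 → ℝ) (u : ℝ → T3 → V3), IsHardSphereEulerSolution σ T ρ u θ → ∀ Φ : (N : ℕ) → HardSphereFlow (Torus.geometry (Fin 3)) (hsDiameter σ N) (N + 1), TendstoHydroFieldsAt (fun N => localGibbsLaw σ a₀ u₀ θ₀ N (Φ N)) Φ ρ u θ 0 → ∀ τ : ℝ, 0 < τ → τ < T → ∀ χ : ℝ × UnitAddTorus (Fin 3) → ℝ, Continuous χ → ∀ g : ℝ → ℝ, Continuous g → (∀ a, η₀ ≤ a → g a = 0) → ∀ Ψ : V3 × V3 × V3 → ℝ, Continuous Ψ → (∃ C : ℝ, ∀ q, |Ψ q| ≤ C) → (∀ (n v w : V3), ‖n‖ = 1 → Ψ (-n, (reflectVel n (v, w)).1, (reflectVel n (v, w)).2) = -Ψ (n, v, w)) → ∀ η δ : ℝ, 0 < η → 0 < δ → ∃ r₀ : ℝ, 0 < r₀ ∧ ∀ r ϑ : ℝ, 0 < r → r < r₀ → 0 < ϑ → ϑ < r₀ → ∃ K₀ : ℕ, ∀ K : ℕ, K₀ ≤ K → ∃ N₀ : ℕ, ∀ N : ℕ, N₀ ≤ N → localGibbsLaw σ a₀ u₀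 θ₀ N (Φ N) {z | η < |metroOddStat σ N (Φ N) τ χ g Ψ r ϑ z - metroOddStat σ N (Φ N) τ χ g Ψ ((K : ℝ) ^ (1 / 4 : ℝ) * ((N + 1 : ℕ) : ℝ) ^ (-(1 / 3 : ℝ))) ϑ z|} ≤ ENNReal.ofReal δ) → OddContactSymmetry := by
  intro hS1 hS6
  rw [oddContactSymmetry_iff_metroOddStat]
  obtain ⟨η₁, hη₁, hW⟩ := windowRate_of_slabPressure hS1
  obtain ⟨η₂, hη₂, hS⟩ := hS6
  refine ⟨min η₁ η₂, lt_min hη₁ hη₂, ?_⟩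
  intro a₀ θ₀ u₀ ha hθ hu ha0 hθ0
  -- a reference temperature dominating `θ₀` (compact torus)
  obtain ⟨Cθ, hCθ⟩ :=
    (isCompact_univ (X := UnitAddTorus (Fin 3))).exists_bound_of_continuousOn hθ.continuousOn
  set θe : ℝ := |Cθ| + 1 with hθe_def
  have hθe : 0 < θe := by positivity
  have h2θe : ∀ x, θ₀ x < 2 * θe := by
    intro x
    have h1 : θ₀ x ≤ |Cθ| := by
      have := hCθ x (mem_univ x)
      rw [Real.norm_eq_abs] at this
      exact (le_abs_self _).trans (this.trans (le_abs_self _))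
    rw [hθe_def]
    linarith [abs_nonneg Cθ]
  obtain ⟨σ₁, hσ₁, hTI⟩ := transferInequality_proof a₀ θ₀ u₀ ha hθ hu ha0 hθ0 θe h2θe
  obtain ⟨σ₂, hσ₂, hWR⟩ := hW θe hθe
  obtain ⟨σ₃, hσ₃, hST⟩ := hS a₀ θ₀ u₀ ha hθ hu ha0 hθ0
  refine ⟨min (min σ₁ σ₂) σ₃, lt_min (lt_min hσ₁ hσ₂) hσ₃, ?_⟩
  intro σ hσ hσlt T ρ θ u hsol Φ hLLN τ hτ hτT χ hχ g hg hg0 Ψ hΨ hΨb hΨodd η δ hη hδ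
  have hσ₁' : σ < σ₁ := hσlt.trans_le ((min_le_left _ _).trans (min_le_left _ _))
  have hσ₂' : σ < σ₂ := hσlt.trans_le ((min_le_left _ _).trans (min_le_right _ _))
  have hσ₃' : σ < σ₃ := hσlt.trans_le (min_le_right _ _)
  have hg₁ : ∀ a, η₁ ≤ a → g a = 0 := fun a ha' => hg0 a ((min_le_left _ _).trans ha')
  have hg₂ : ∀ a, η₂ ≤ a → g a = 0 := fun a ha' => hg0 a ((min_le_right _ _).trans ha')
  obtain ⟨C, hC⟩ := hTI σ hσ hσ₁'
  have hη2 : 0 < η / 2 := by positivity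
  have hδ2 : 0 < δ / 2 := by positivity
  obtain ⟨r₀, hr₀, hr⟩ := hST σ hσ hσ₃' T ρ θ u hsol Φ hLLN τ hτ hτT χ hχ g hg hg₂ Ψ hΨ hΨb hΨodd
    (η / 2) (δ / 2) hη2 hδ2
  refine ⟨r₀, hr₀, ?_⟩
  intro r ϑ hr0 hrr hϑ0 hϑr
  obtain ⟨K₁, hK₁⟩ := hr r ϑ hr0 hrr hϑ0 hϑr
  set M : ℝ := |C| + 1 with hM_def
  have hM : 0 < M := by positivity
  obtain ⟨K₂, hK₂⟩ := hWR σ hσ hσ₂' Φ τ hτ χ hχ g hg hg₁ Ψ hΨ hΨb hΨodd ϑ hϑ0 (η / 2) M hη2 hM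
  obtain ⟨N₁, hN₁⟩ := hK₁ (max K₁ K₂) (le_max_left _ _)
  obtain ⟨N₂, hN₂⟩ := hK₂ (max K₁ K₂) (le_max_right _ _)
  -- `exp (-(N+1)/2) ≤ δ/2` eventually
  obtain ⟨N₃, hN₃⟩ : ∃ N₃ : ℕ, ∀ N : ℕ, N₃ ≤ N → Real.exp (-((N : ℝ) + 1) / 2) ≤ δ / 2 := by
    have ht : Tendsto (fun N : ℕ => Real.exp (-((N : ℝ) + 1) / 2)) atTop (𝓝 0) := by
      refine Real.tendsto_exp_atBot.comp ?_
      have h1 : Tendsto (fun N : ℕ => (N : ℝ) + 1) atTop atTop :=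
        tendsto_natCast_atTop_atTop.atTop_add tendsto_const_nhds
      have h2 : Tendsto (fun N : ℕ => -((N : ℝ) + 1)) atTop atBot := tendsto_neg_atTop_atBot.comp h1
      simpa [neg_div] using h2.atBot_div_const (by norm_num : (0 : ℝ) < 2)
    obtain ⟨N₃, hN₃⟩ := eventually_atTop.1 (ht.eventually (Iic_mem_nhds hδ2))
    exact ⟨N₃, fun N hN => hN₃ N hN⟩
  refine ⟨max (max N₁ N₂) N₃, fun N hN => ?_⟩
  have hN₁' : N₁ ≤ N := ((le_max_left _ _).trans (le_max_left _ _)).trans hN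
  have hN₂' : N₂ ≤ N := ((le_max_right _ _).trans (le_max_left _ _)).trans hN
  have hN₃' : N₃ ≤ N := (le_max_right _ _).trans hN
  set K : ℕ := max K₁ K₂ with hK_def
  set P := localGibbsLaw σ a₀ u₀ θ₀ N (Φ N) with hP_def
  set D : Config (N + 1) (Fin 3) T3 → ℝ := fun z => metroOddStat σ N (Φ N) τ χ g Ψ r ϑ z with hD_def
  set D' : Config (N + 1) (Fin 3) T3 → ℝ := fun z => metroOddStat σ N (Φ N) τ χ g Ψ
    ((K : ℝ) ^ (1 / 4 : ℝ) * ((N + 1 : ℕ) : ℝ) ^ (-(1 / 3 : ℝ))) ϑ z with hD'_def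
  -- the mesoscale event, transferred from the invariant Gibbs law
  have hA : P {z | η / 2 < |D' z|} ≤ ENNReal.ofReal (δ / 2) := by
    have h1 := hC N (Φ N) {z | η / 2 < |D' z|}
    have h2 := hN₂ N hN₂'
    have hN0 : (0 : ℝ) ≤ (N : ℝ) + 1 := by positivity
    have hCM : (C - M) * ((N : ℝ) + 1) ≤ -((N : ℝ) + 1) := by
      have : C - M ≤ -1 := by rw [hM_def]; linarith [le_abs_self C]
      nlinarith
    have h3 : P {z | η / 2 < |D' z|} ^ 2 ≤ ENNReal.ofReal (Real.exp (-((N : ℝ) + 1) / 2)) ^ 2 := by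
      calc P {z | η / 2 < |D' z|} ^ 2
          ≤ ENNReal.ofReal (Real.exp (C * (N + 1))) *
              ENNReal.ofReal (Real.exp (-(M * ((N : ℝ) + 1)))) := h1.trans (by gcongr)
        _ = ENNReal.ofReal (Real.exp ((C - M) * ((N : ℝ) + 1))) := by
            rw [← ENNReal.ofReal_mul (Real.exp_pos _).le, ← Real.exp_add]
            congr 1; congr 1; ring
        _ ≤ ENNReal.ofReal (Real.exp (-((N : ℝ) + 1))) :=
            ENNReal.ofReal_le_ofReal (Real.exp_le_exp.2 hCM)
        _ = ENNReal.ofReal (Real.exp (-((N : ℝ) + 1) / 2)) ^ 2 := by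
            rw [← ENNReal.ofReal_pow (Real.exp_pos _).le, ← Real.exp_nat_mul]
            congr 1; congr 1; push_cast; ring
    exact ((ENNReal.pow_le_pow_left_iff two_ne_zero).1 h3).trans
      (ENNReal.ofReal_le_ofReal (hN₃ N hN₃'))
  -- the two-scale event, from (2B)
  have hB : P {z | η / 2 < |D z - D' z|} ≤ ENNReal.ofReal (δ / 2) := hN₁ N hN₁'
  have hsub : {z | η < |D z|} ⊆ {z | η / 2 < |D' z|} ∪ {z | η / 2 < |D z - D' z|} := by
    intro z hz
    simp only [mem_setOf_eq, mem_union] at hz ⊢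
    by_contra hcon
    push Not at hcon
    have := abs_sub_abs_le_abs_sub (D z) (D' z)
    linarith [hcon.1, hcon.2]
  calc P {z | η < |D z|}
      ≤ P ({z | η / 2 < |D' z|} ∪ {z | η / 2 < |D z - D' z|}) := measure_mono hsub
    _ ≤ P {z | η / 2 < |D' z|} + P {z | η / 2 < |D z - D' z|} := measure_union_le _ _
    _ ≤ ENNReal.ofReal (δ / 2) + ENNReal.ofReal (δ / 2) := add_le_add hA hB
    _ = ENNReal.ofReal δ := by rw [← ENNReal.ofReal_add hδ2.le hδ2.le, add_halves]

end Summit.AtomisticToContinuum.HydrodynamicLimit.Theorems.OddContactSymmetryKineticSlab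

end
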